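import Mathlib
import HarnessLib
import Summits.Ventures.LatticeQCDFlow.Scoring.MarkovChainCLTCoverage
import Summits.Ventures.LatticeQCDFlow.Scoring.FlowSamplerRegenerative

/-!
# The exact flow sampler on `SU(n)^E`: TIME AVERAGES ARE ASYMPTOTICALLY NORMAL with the Green–Kubo
# (`τ_int`) variance, `√m (f̄_m − π f) ⇒ N(0, σ²_f)`, from ANY initial configuration — UNCONDITIONAL

HONEST FRAMING: exact (Metropolis-corrected) sampling algorithms for lattice gauge theory;
figures of merit are autocorrelation/cost numbers at stated couplings and volumes; no
continuum-physics claim.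

Venture `LatticeQCDFlow` (cell pub-lqcd), topic `Scoring`; FANOUT row 8 (`s0-cpn-nemc`, GEN-18).
NEW WORK of the cell, not a published result; no definition is introduced.  The `SU(n)^E` instance
of the Markov-chain central limit theorem `Scoring/MarkovChainCLT.markovChain_clt`, composed —
exactly as `Scoring/FlowSamplerRegenerative.lean` — with the tree's UNCONDITIONAL exact flow-MCMC
theorem `Exactness.flowSampler_exact_doeblin`: a uniform defect `δ` of Lüscher's flow equation
gives a weight `w = dπ/dq ∈ [e^{−2δ}, e^{2δ}]`, exactness of `K = indepMH q w` for
`π = 𝒵⁻¹ e^{−S} D[U]`, and the Doeblin bound `K(U, ·) ≥ e^{−2δ} π`.  Consequently, for every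
bounded measurable observable `f` and EVERY initial configuration law `μ₀`, the flow-MCMC time
average `f̄_m = (1/m) Σ_{t<m} f(U_t)` satisfies `√m (f̄_m − π f) ⇒ N(0, σ²_f)` with
`σ²_f = Var_π f + 2 Σ_{k≥1} Cov_π(f, K^k f)` — the integrated-autocorrelation variance the row's
`τ_int` certificates bound (`Scoring/FlowSamplerAutocorrelation.lean`: `τ_int ≤ coth δ`) — and the
coverage of `f̄_m ± r/√m` converges to the Gaussian value.  Printed counterpart NAMED ONLY: the CLT
for uniformly ergodic chains (Meyn–Tweedie 1993 Thm 17.0.1); no flow paper states a limit theorem —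
nothing is cited as a fact.

## Content (hypotheses of `Scoring.flowSampler_regenerative`; `π = 𝒵⁻¹e^{−S}D[U]`, `K = indepMH q w`)

* **`flowSampler_timeAverage_clt`** — `∃ w` (the weight) with the Doeblin bound, `w·q = π`, `π K = π`,
  such that for every initial law `μ₀` and every bounded measurable `f`:
  `TendstoInDistribution (fun m x => (√m)⁻¹ Σ_{t<m} (f(x_t) − π f)) atTop id P_{μ₀} (gaussianReal 0 σ²_f)`
  and, for every `r > 0`, `P_{μ₀}(|√m (f̄_m − π f)| ≤ r) → (gaussianReal 0 σ²_f)[−r, r]`.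

NOT CLAIMED: any value of `δ`; a rate; `σ²_f > 0`; the cost of a flow-MCMC step.
-/

noncomputable section

namespace Summit.Ventures.LatticeQCDFlow.Scoring

open MeasureTheory ProbabilityTheory Filter Finset Summit.Ventures.LatticeQCDFlow.Exactness
open Literature.MathematicalPhysics.QuantumFieldTheory
open Literature.MathematicalPhysics.QuantumFieldTheory.Luscher2010
open Summit.Ventures.LatticeQCDFlow.TrivializingMaps
open Literature.Probability.MarkovChains
open scoped ENNReal Matrix Matrix.Norms.Frobenius ContDiff Topology

variable {d L n : ℕ} [NeZero L]

/-- **TIME AVERAGES OF THE EXACT FLOW SAMPLER ARE ASYMPTOTICALLY NORMAL — UNCONDITIONAL, any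
start.**  See the module docstring.  (The inner instance binder `[IsProbabilityMeasure P_{μ₀}]` is
`inferInstance` at every use.) -/
theorem flowSampler_timeAverage_clt (B : SuBasis n)
    {S : AmbConfig d L n → ℝ} (hS : ContDiff ℝ ∞ S) {F : ℝ → AmbConfig d L n → ℝ}
    (hF : ContDiff ℝ ∞ fun p : ℝ × AmbConfig d L n => F p.1 p.2)
    {Φ : ℝ → GaugeConfig d L (Matrix.specialUnitaryGroup (Fin n) ℂ) → GaugeConfig d L (Matrix.specialUnitaryGroup (Fin n) ℂ)}
    (hΦ : IsFlowMap (fun t W => -linkGrad B (F t) W) Φ) {c : ℝ → ℝ} {δ : ℝ} (hδ0 : 0 < δ)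
    (hδ : ∀ t ∈ Set.Icc (0 : ℝ) 1, ∀ U : GaugeConfig d L (Matrix.specialUnitaryGroup (Fin n) ℂ),
      |luscherL B S t (F t) (WilsonFlow.coeConfig U) - S (WilsonFlow.coeConfig U) - c t| ≤ δ)
    (q : Measure (GaugeConfig d L (Matrix.specialUnitaryGroup (Fin n) ℂ))) [IsProbabilityMeasure q]
    (hq : q = Measure.map (Φ 1) (trivialMeasure (Matrix.specialUnitaryGroup (Fin n) ℂ) d L)) :
    ∃ w : GaugeConfig d L (Matrix.specialUnitaryGroup (Fin n) ℂ) → ℝ, ∃ hw : Measurable w,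
      (∀ (U : GaugeConfig d L (Matrix.specialUnitaryGroup (Fin n) ℂ)) {A : Set (GaugeConfig d L (Matrix.specialUnitaryGroup (Fin n) ℂ))}, MeasurableSet A →
          ENNReal.ofReal (Real.exp (-(2 * δ))) * (boltzmannMeasure fun U : GaugeConfig d L (Matrix.specialUnitaryGroup (Fin n) ℂ) => S (WilsonFlow.coeConfig U)) A ≤ indepMH q w U A) ∧
      (q.withDensity fun U => ENNReal.ofReal (w U)) = (boltzmannMeasure fun U : GaugeConfig d L (Matrix.specialUnitaryGroup (Fin n) ℂ) => S (WilsonFlow.coeConfig U)) ∧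
      Kernel.Invariant (indepMH q w) (boltzmannMeasure fun U : GaugeConfig d L (Matrix.specialUnitaryGroup (Fin n) ℂ) => S (WilsonFlow.coeConfig U)) ∧
      haveI : Fact (Measurable w) := ⟨hw⟩
      ∀ (μ₀ : Measure (GaugeConfig d L (Matrix.specialUnitaryGroup (Fin n) ℂ))) [IsProbabilityMeasure μ₀]
        [IsProbabilityMeasure (Kernel.trajMeasure (X := fun _ : ℕ => GaugeConfig d L (Matrix.specialUnitaryGroup (Fin n) ℂ)) μ₀
              (fun j : ℕ => (indepMH q w).comap (fun y : (i : ↥(Finset.Iic j)) → GaugeConfig d L (Matrix.specialUnitaryGroup (Fin n) ℂ) =>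
                y ⟨j, Finset.mem_Iic.2 le_rfl⟩) (measurable_pi_apply _)))]
        (f : GaugeConfig d L (Matrix.specialUnitaryGroup (Fin n) ℂ) → ℝ), Measurable f → ∀ C : ℝ, (∀ U, |f U| ≤ C) →
        let π := boltzmannMeasure fun U : GaugeConfig d L (Matrix.specialUnitaryGroup (Fin n) ℂ) => S (WilsonFlow.coeConfig U)
        TendstoInDistribution (fun (m : ℕ) (x : ℕ → GaugeConfig d L (Matrix.specialUnitaryGroup (Fin n) ℂ)) => (Real.sqrt m)⁻¹ * ∑ t ∈ Finset.range m, (f (x t) - ∫ V, f V ∂π))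
          atTop (fun a : ℝ => a) (fun _ => (Kernel.trajMeasure (X := fun _ : ℕ => GaugeConfig d L (Matrix.specialUnitaryGroup (Fin n) ℂ)) μ₀
              (fun j : ℕ => (indepMH q w).comap (fun y : (i : ↥(Finset.Iic j)) → GaugeConfig d L (Matrix.specialUnitaryGroup (Fin n) ℂ) =>
                y ⟨j, Finset.mem_Iic.2 le_rfl⟩) (measurable_pi_apply _))))
          (gaussianReal 0 (Real.toNNReal ((∫ V, (f V - ∫ V', f V' ∂π) ^ 2 ∂π)
                + 2 * ∑' k, ∫ V, (f V - ∫ V', f V' ∂π)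
                  * (kop (indepMH q w))^[k + 1] (fun V => f V - ∫ V', f V' ∂π) V ∂π)))
        ∧ ∀ r : ℝ, 0 < r →
          Tendsto (fun m : ℕ => (Kernel.trajMeasure (X := fun _ : ℕ => GaugeConfig d L (Matrix.specialUnitaryGroup (Fin n) ℂ)) μ₀
              (fun j : ℕ => (indepMH q w).comap (fun y : (i : ↥(Finset.Iic j)) → GaugeConfig d L (Matrix.specialUnitaryGroup (Fin n) ℂ) =>
                y ⟨j, Finset.mem_Iic.2 le_rfl⟩) (measurable_pi_apply _))).real
            {x | |(Real.sqrt m)⁻¹ * ∑ t ∈ Finset.range m, (f (x t) - ∫ V, f V ∂π)| ≤ r})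
            atTop (𝓝 ((gaussianReal 0 (Real.toNNReal ((∫ V, (f V - ∫ V', f V' ∂π) ^ 2 ∂π)
                + 2 * ∑' k, ∫ V, (f V - ∫ V', f V' ∂π)
                  * (kop (indepMH q w))^[k + 1] (fun V => f V - ∫ V', f V' ∂π) V ∂π))).real (Set.Icc (-r) r))) := by
  obtain ⟨w, hw, hwlo, -, hπ, hinv, -, hdoeb⟩ := flowSampler_exact_doeblin B hS hF hΦ hδ q hq
  haveI : Fact (Measurable w) := ⟨hw⟩
  have hS'c : Continuous fun U : GaugeConfig d L (Matrix.specialUnitaryGroup (Fin n) ℂ) => S (WilsonFlow.coeConfig U) :=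
    hS.continuous.comp WilsonFlow.continuous_coeConfig
  haveI := isProbabilityMeasure_boltzmannMeasure (d := d) (L := L) hS'c
  have he0 : 0 < Real.exp (-(2 * δ)) := Real.exp_pos _
  have hε0 : 0 < ENNReal.ofReal (Real.exp (-(2 * δ))) := ENNReal.ofReal_pos.2 he0
  have hε1 : ENNReal.ofReal (Real.exp (-(2 * δ))) < 1 := by
    rw [ENNReal.ofReal_lt_one]; exact Real.exp_lt_one_iff.2 (by linarith)
  have _ := hwlo
  refine ⟨w, hw, fun U _ hA => hdoeb U hA, hπ, hinv, fun μ₀ _ _ f hf C hC => ⟨?_, fun r hr => ?_⟩⟩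
  · have hY : HasLaw (fun a : ℝ => a) (gaussianReal 0 (Real.toNNReal ((∫ V, (f V - ∫ V', f V' ∂(boltzmannMeasure fun U : GaugeConfig d L (Matrix.specialUnitaryGroup (Fin n) ℂ) => S (WilsonFlow.coeConfig U))) ^ 2 ∂(boltzmannMeasure fun U : GaugeConfig d L (Matrix.specialUnitaryGroup (Fin n) ℂ) => S (WilsonFlow.coeConfig U)))
                + 2 * ∑' k, ∫ V, (f V - ∫ V', f V' ∂(boltzmannMeasure fun U : GaugeConfig d L (Matrix.specialUnitaryGroup (Fin n) ℂ) => S (WilsonFlow.coeConfig U)))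
                  * (kop (indepMH q w))^[k + 1] (fun V => f V - ∫ V', f V' ∂(boltzmannMeasure fun U : GaugeConfig d L (Matrix.specialUnitaryGroup (Fin n) ℂ) => S (WilsonFlow.coeConfig U))) V ∂(boltzmannMeasure fun U : GaugeConfig d L (Matrix.specialUnitaryGroup (Fin n) ℂ) => S (WilsonFlow.coeConfig U)))))
        (gaussianReal 0 (Real.toNNReal ((∫ V, (f V - ∫ V', f V' ∂(boltzmannMeasure fun U : GaugeConfig d L (Matrix.specialUnitaryGroup (Fin n) ℂ) => S (WilsonFlow.coeConfig U))) ^ 2 ∂(boltzmannMeasure fun U : GaugeConfig d L (Matrix.specialUnitaryGroup (Fin n) ℂ) => S (WilsonFlow.coeConfig U)))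
                + 2 * ∑' k, ∫ V, (f V - ∫ V', f V' ∂(boltzmannMeasure fun U : GaugeConfig d L (Matrix.specialUnitaryGroup (Fin n) ℂ) => S (WilsonFlow.coeConfig U)))
                  * (kop (indepMH q w))^[k + 1] (fun V => f V - ∫ V', f V' ∂(boltzmannMeasure fun U : GaugeConfig d L (Matrix.specialUnitaryGroup (Fin n) ℂ) => S (WilsonFlow.coeConfig U))) V ∂(boltzmannMeasure fun U : GaugeConfig d L (Matrix.specialUnitaryGroup (Fin n) ℂ) => S (WilsonFlow.coeConfig U))))) :=
      ⟨aemeasurable_id', Measure.map_id'⟩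
    exact markovChain_clt (κ := indepMH q w) (ν := (boltzmannMeasure fun U : GaugeConfig d L (Matrix.specialUnitaryGroup (Fin n) ℂ) => S (WilsonFlow.coeConfig U))) hinv (fun U _ hA => hdoeb U hA) hε0 hε1
      hf hC μ₀ hY
  · exact markovChain_clt_coverage (κ := indepMH q w) (ν := (boltzmannMeasure fun U : GaugeConfig d L (Matrix.specialUnitaryGroup (Fin n) ℂ) => S (WilsonFlow.coeConfig U))) hinv (fun U _ hA => hdoeb U hA)
      hε0 hε1 hf hC μ₀ hr

end Summit.Ventures.LatticeQCDFlow.Scoring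

end
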